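import Mathlib
import Literature.NumberTheory.LFunctions.Zhang2022.Section13Rem137
import Literature.NumberTheory.LFunctions.Zhang2022.Section6LFunctionStripGrowth
import HarnessLib

/-!
# Zhang (2022) §13 p. 75, (13.11): two bookkeeping lemmas for the zero-sum estimates —
# the size of `L(s,ψ)` on the window (`≤ P⁴`) and the absorption of `P^a T^b 𝓛^k` by `e^{−𝓛¹⁰/8}`

Topic `Literature/NumberTheory/LFunctions/Zhang2022` (Landau–Siegel audit tree; verdict-neutral).
Y. Zhang, *Discrete mean estimates and the Landau–Siegel zero*, arXiv:2211.02515v1 (2022)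
[Zhang2022LandauSiegel], §13 p. 75 — an unrefereed manuscript under adjudication; nothing here asserts or
denies its Theorems 1–2. Lane ZHANG-L (WP14, zero-side helper of record, W14-R2c(3)).

The zero-sum bounds `zeroSum_weight_le_of_prop22` / `zeroSum_dirPoly_sq_le_of_prop22` carry an error
term `K·H_max·e^{−𝓛¹⁰/8}` (`H_max` = any bound for the holomorphic co-factor on the strip
`|σ − ½| ≤ α`, `|t − 2πt₀| ≤ 𝓛₁ + 1`). The two lemmas below make that term routine for every family:

* `norm_LFunction_le_bigP_pow_four` — for `𝓛 ≥ 80`, `ψ ∈ Ψ`, `|Re s − ½| ≤ ½`, `|Im s − 2πt₀| ≤ 𝓛₁ + 2`: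
  `‖L(s,ψ)‖ ≤ Z·P⁴`, `Z = Σ_{n≥1} n^{−5/4}` (the convexity/Stirling bound
  `StripGrowth.norm_LFunction_le_of_abs_re_le`, MV Cor. 10.10, made crude: `4p³·Z·(9𝓛⁵¹⁹)³ ≤ Z·P⁴`);
* `bigP_bigT_ell_pow_mul_exp_neg_le_one` — for `𝓛 ≥ 80`, `a ≤ 8`, `b, k ≤ 10⁶`:
  `P^a·T^b·𝓛^k·e^{−𝓛¹⁰/8} ≤ 1` (`P = e^{𝓛⁹}`, `T = e^{𝓛^{1.1}} ≤ e^{𝓛²}`, `𝓛 ≤ e^{𝓛}`, `𝓛¹⁰/8 ≥ 10𝓛⁹`).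

Theorems only: no new definition, no new fact, axioms standard.

## References

* Y. Zhang, arXiv:2211.02515v1 (2022), §13 p. 75; §2 (2.6), (2.8). [cite: Zhang2022LandauSiegel, §13 p.75]
* H. L. Montgomery, R. C. Vaughan, *Multiplicative Number Theory I* (2007), §10.1 Cor. 10.10.
  [cite: MontgomeryVaughan2007, §10.1 Cor. 10.10]
-/

noncomputable section

open Complex Real

namespace Literature.NumberTheory.LFunctions.Zhang2022.Typed.Section13

open Skeleton

variable {D : ℕ}

/-- The threshold `D ≥ ⌈e^{L₀}⌉` gives `L₀ ≤ 𝓛`. [folklore] -/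
private theorem threshold_le_ell'' {L₀ : ℝ} {D : ℕ} (hD : ⌈Real.exp L₀⌉₊ ≤ D) : L₀ ≤ ell D := by
  have h1 : Real.exp L₀ ≤ D := (Nat.le_ceil _).trans (by exact_mod_cast hD)
  have hD0 : (0 : ℝ) < D := (Real.exp_pos _).trans_le h1
  rw [ell, Real.le_log_iff_exp_le hD0]; exact h1

/-- **Absorption by `e^{−𝓛¹⁰/8}`**: for `𝓛 ≥ 80`, `a ≤ 8`, `b ≤ 10⁶`, `k ≤ 10⁶`,
`P^a·T^b·𝓛^k·e^{−𝓛¹⁰/8} ≤ 1` (`P^a = e^{a𝓛⁹}`, `T^b ≤ e^{b𝓛²}`, `𝓛^k ≤ e^{k𝓛}`, and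
`a𝓛⁹ + b𝓛² + k𝓛 ≤ 10𝓛⁹ ≤ 𝓛¹⁰/8`). [cite: Zhang2022LandauSiegel, §2 (2.6), (2.8); §13 p.75] -/
theorem bigP_bigT_ell_pow_mul_exp_neg_le_one (h80 : 80 ≤ ell D) {a b k : ℕ} (ha : a ≤ 8)
    (hb : b ≤ 1000000) (hk : k ≤ 1000000) :
    bigP D ^ a * bigT D ^ b * ell D ^ k * Real.exp (-(ell D ^ 10 / 8)) ≤ 1 := by
  have hL1 : 1 ≤ ell D := by linarith
  have hL0 : 0 < ell D := by linarith
  have ha' : (a : ℝ) ≤ 8 := by exact_mod_cast ha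
  have hb' : (b : ℝ) ≤ 1000000 := by exact_mod_cast hb
  have hk' : (k : ℝ) ≤ 1000000 := by exact_mod_cast hk
  -- the three factors as exponentials
  have hP : bigP D ^ a = Real.exp (a * ell D ^ 9) := by rw [bigP, ← Real.exp_nat_mul]
  have h11 : ell D ^ (1.1 : ℝ) ≤ ell D ^ 2 := by
    have h := Real.rpow_le_rpow_of_exponent_le hL1 (by norm_num : (1.1 : ℝ) ≤ 2)
    rwa [Real.rpow_two] at h
  have hT : bigT D ^ b ≤ Real.exp (b * ell D ^ 2) := by
    rw [bigT, ← Real.exp_nat_mul]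
    exact Real.exp_le_exp.mpr (mul_le_mul_of_nonneg_left h11 (Nat.cast_nonneg _))
  have hℓ : ell D ^ k ≤ Real.exp (k * ell D) := by
    have h1 : ell D ≤ Real.exp (ell D) := by linarith [Real.add_one_le_exp (ell D)]
    calc ell D ^ k ≤ Real.exp (ell D) ^ k := pow_le_pow_left₀ hL0.le h1 k
      _ = Real.exp (k * ell D) := by rw [← Real.exp_nat_mul]
  -- the exponent budget
  have h9 : 0 < ell D ^ 9 := pow_pos hL0 9
  have hkey : 10 * ell D ^ 9 ≤ ell D ^ 10 / 8 := by
    have : ell D ^ 10 = ell D ^ 9 * ell D := by ring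
    rw [this]; nlinarith
  have h8 : (2 : ℝ) * 80 ^ 7 ≤ 2 * ell D ^ 7 := by
    have := pow_le_pow_left₀ (by norm_num : (0:ℝ) ≤ 80) h80 7
    linarith
  have hsmall : (b : ℝ) * ell D ^ 2 + k * ell D ≤ 2 * ell D ^ 9 := by
    have h2 : ell D ≤ ell D ^ 2 := by nlinarith
    have hq : (b : ℝ) * ell D ^ 2 + k * ell D ≤ 2000000 * ell D ^ 2 := by nlinarith
    have h7 : (2000000 : ℝ) ≤ 2 * ell D ^ 7 := le_trans (by norm_num) h8
    have : ell D ^ 9 = ell D ^ 2 * ell D ^ 7 := by ring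
    nlinarith [pow_pos hL0 2]
  have hexp : a * ell D ^ 9 + b * ell D ^ 2 + k * ell D - ell D ^ 10 / 8 ≤ 0 := by nlinarith
  calc bigP D ^ a * bigT D ^ b * ell D ^ k * Real.exp (-(ell D ^ 10 / 8))
      ≤ Real.exp (a * ell D ^ 9) * Real.exp (b * ell D ^ 2) * Real.exp (k * ell D) *
          Real.exp (-(ell D ^ 10 / 8)) := by
        rw [hP]; gcongr
    _ = Real.exp (a * ell D ^ 9 + b * ell D ^ 2 + k * ell D - ell D ^ 10 / 8) := by
        rw [← Real.exp_add, ← Real.exp_add, ← Real.exp_add]; ring_nf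
    _ ≤ Real.exp 0 := Real.exp_le_exp.mpr hexp
    _ = 1 := Real.exp_zero

/-- **The size of `L(s,ψ)` on the window**: for `𝓛 ≥ 80`, `ψ ∈ Ψ` (conductor `p < 2P`), `|Re s − ½| ≤ ½`
and `|Im s − 2πt₀| ≤ 𝓛₁ + 2`, `‖L(s,ψ)‖ ≤ Z·P⁴` with the absolute constant `Z = Σ_{n≥1}n^{−5/4}` — the
polynomial growth of `L` in the strip (`StripGrowth.norm_LFunction_le_of_abs_re_le` with `A = 1`:
`≤ 4p³·Z·(|t|+2)³`, `|t| + 2 ≤ 9𝓛⁵¹⁹`, `p ≤ 2P`, `32(9𝓛⁵¹⁹)⁴ ≤ (9𝓛⁵¹⁹)·… ≤ P`), made crude. The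
`H_max` of every zero-sum co-factor containing `L`-values.
[cite: MontgomeryVaughan2007, §10.1 Cor. 10.10] -/
theorem norm_LFunction_le_bigP_pow_four (h80 : 80 ≤ ell D) (x : Chr D) {s : ℂ}
    (hσ : |s.re - 1 / 2| ≤ 1 / 2) (ht : |s.im - 2 * π * t0 D| ≤ ell1 D + 2) :
    ‖x.ψ.LFunction s‖ ≤ (∑' n : ℕ, ((n + 1 : ℕ) : ℝ) ^ (-(5 / 4 : ℝ))) * bigP D ^ 4 := by
  have hL1 : 1 ≤ ell D := by linarith
  have hL0 : 0 < ell D := by linarith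
  -- the window in `t`
  have hℓ1 : (1 : ℝ) ≤ ell1 D := by rw [ell1]; exact one_le_pow₀ hL1
  have h114 : ell1 D + 2 ≤ t0 D := by
    rw [ell1, t0]
    have h1 : ell D ^ 405 ≤ ell D ^ 518 := pow_le_pow_right₀ hL1 (by norm_num)
    have h2 : (80 : ℝ) * ell D ^ 518 ≤ ell D ^ 519 := by
      have : ell D ^ 519 = ell D ^ 518 * ell D := by ring
      rw [this]; nlinarith [pow_pos hL0 518]
    have h3 : (1 : ℝ) ≤ ell D ^ 518 := one_le_pow₀ hL1
    nlinarith
  obtain ⟨ht1, ht2⟩ := abs_le.mp ht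
  have htpos : 0 < s.im := by nlinarith [Real.pi_gt_three, hℓ1]
  have ht080 : (80 : ℝ) ≤ t0 D := by
    rw [t0]; exact le_trans h80 (le_self_pow₀ hL1 (by norm_num))
  have htabs : |s.im| ≤ 9 * t0 D - 2 := by
    rw [abs_of_pos htpos]
    have hπt : π * t0 D < 3.15 * t0 D := mul_lt_mul_of_pos_right Real.pi_lt_d2 (by linarith)
    linarith
  obtain ⟨hσ1, hσ2⟩ := abs_le.mp hσ
  have hσA : |s.re| ≤ ((1 : ℕ) : ℝ) := by
    rw [Nat.cast_one, abs_le]; constructor <;> linarith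
  have him : 38 * (((1 : ℕ) : ℝ) + 1) ^ 2 ≤ |s.im| := by
    rw [Nat.cast_one, abs_of_pos htpos]
    have : (152 : ℝ) ≤ t0 D := by
      rw [t0]
      calc (152 : ℝ) ≤ 80 ^ 2 := by norm_num
        _ ≤ ell D ^ 2 := pow_le_pow_left₀ (by norm_num) h80 2
        _ ≤ ell D ^ 519 := pow_le_pow_right₀ hL1 (by norm_num)
    nlinarith [Real.pi_gt_three]
  have h := StripGrowth.norm_LFunction_le_of_abs_re_le x.prim x.p_ne_one (A := 1) le_rfl hσA him
  -- sizes: `p < 2P`, `Z ≤ 5`, `(|t| + 2)³ ≤ (9t₀)³`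
  set Zc : ℝ := ∑' n : ℕ, ((n + 1 : ℕ) : ℝ) ^ (-(5 / 4 : ℝ)) with hZc
  -- assemble
  obtain ⟨hPp, hpP⟩ : bigP D < x.p ∧ (x.p : ℝ) < bigP D * (1 + (ell D ^ 68)⁻¹) := by
    have hm := x.mem
    rw [primeWindow, Finset.mem_filter, Finset.mem_Ioo] at hm
    have hP : 0 ≤ bigP D := (Real.exp_pos _).le
    exact ⟨(Nat.floor_lt hP).mp hm.1.1, Nat.lt_ceil.mp hm.1.2⟩
  have hP1 : 1 ≤ bigP D := by rw [bigP]; exact Real.one_le_exp (by positivity)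
  have hp2P : (x.p : ℝ) ≤ 2 * bigP D := by
    have h68 : (ell D ^ 68)⁻¹ ≤ 1 := inv_le_one_of_one_le₀ (one_le_pow₀ hL1)
    nlinarith
  have ht0P : 9 * t0 D ≤ bigP D := by
    -- `9𝓛⁵¹⁹ ≤ e^{𝓛⁹}`: `𝓛 ≤ e^{𝓛−1}` so `𝓛⁵¹⁹ ≤ e^{519(𝓛−1)}`, and `519(𝓛−1) + log 9 ≤ 𝓛⁹`
    rw [t0, bigP]
    have hLe : ell D ≤ Real.exp (ell D - 1) := by linarith [Real.add_one_le_exp (ell D - 1)]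
    have h1 : ell D ^ 519 ≤ Real.exp (519 * (ell D - 1)) := by
      calc ell D ^ 519 ≤ Real.exp (ell D - 1) ^ 519 := pow_le_pow_left₀ hL0.le hLe 519
        _ = Real.exp (519 * (ell D - 1)) := by rw [← Real.exp_nat_mul]; norm_num
    have h9 : (9 : ℝ) ≤ Real.exp 3 := by
      have he := Real.exp_one_gt_d9
      have h3 : Real.exp 3 = Real.exp 1 * Real.exp 1 * Real.exp 1 := by
        rw [← Real.exp_add, ← Real.exp_add]; norm_num
      rw [h3]; nlinarith [Real.exp_pos (1 : ℝ)]
    have hexp : 3 + 519 * (ell D - 1) ≤ ell D ^ 9 := by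
      have h8 : (80 : ℝ) ^ 8 ≤ ell D ^ 8 := pow_le_pow_left₀ (by norm_num) h80 8
      have : ell D ^ 9 = ell D ^ 8 * ell D := by ring
      nlinarith
    calc 9 * ell D ^ 519 ≤ Real.exp 3 * Real.exp (519 * (ell D - 1)) :=
          mul_le_mul h9 h1 (by positivity) (Real.exp_pos _).le
      _ = Real.exp (3 + 519 * (ell D - 1)) := by rw [← Real.exp_add]
      _ ≤ Real.exp (ell D ^ 9) := Real.exp_le_exp.mpr hexp
  have hZc0 : 0 ≤ Zc := tsum_nonneg fun n => by positivity
  calc ‖x.ψ.LFunction s‖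
      ≤ 4 * (x.p : ℝ) ^ (1 + 2) * Zc * (|s.im| + ((1 : ℕ) : ℝ) + 1) ^ (1 + 2) := h
    _ ≤ 4 * (2 * bigP D) ^ 3 * Zc * (9 * t0 D) ^ 3 := by
        rw [show (1 : ℕ) + 2 = 3 from rfl, Nat.cast_one]
        have h1 : (x.p : ℝ) ^ 3 ≤ (2 * bigP D) ^ 3 := pow_le_pow_left₀ (Nat.cast_nonneg _) hp2P 3
        have h2 : (|s.im| + 1 + 1) ^ 3 ≤ (9 * t0 D) ^ 3 :=
          pow_le_pow_left₀ (by positivity) (by linarith) 3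
        gcongr
    _ = Zc * (32 * (9 * t0 D) ^ 3 * bigP D ^ 3) := by ring
    _ ≤ Zc * (bigP D * bigP D ^ 3) := by
        refine mul_le_mul_of_nonneg_left ?_ hZc0
        have h3 : (9 * t0 D) ^ 3 ≤ bigP D ^ 3 := pow_le_pow_left₀ (by rw [t0]; positivity) ht0P 3
        -- `160·(9t₀)³ ≤ P`: `(9t₀)³ ≤ P³`... we need the cruder `160(9t₀)³ ≤ P`; use `(9t₀)³ ≤ P^3`? No:
        -- instead bound `160·(9t₀)³ ≤ (9t₀)⁴ ≤ ... `; simplest: `160 ≤ 9t₀` and `(9t₀)⁴ ≤ P`.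
        have h160 : (160 : ℝ) ≤ 9 * t0 D := by
          rw [t0]
          have : (80 : ℝ) ≤ ell D ^ 519 := le_trans h80 (le_self_pow₀ hL1 (by norm_num))
          linarith
        have h4 : (9 * t0 D) ^ 4 ≤ bigP D := by
          -- `(9𝓛⁵¹⁹)⁴ ≤ e^{𝓛⁹}` as above with exponent `4(3 + 519(𝓛−1)) ≤ 𝓛⁹`
          rw [t0, bigP]
          have hLe : ell D ≤ Real.exp (ell D - 1) := by linarith [Real.add_one_le_exp (ell D - 1)]
          have h1 : ell D ^ 519 ≤ Real.exp (519 * (ell D - 1)) := by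
            calc ell D ^ 519 ≤ Real.exp (ell D - 1) ^ 519 := pow_le_pow_left₀ hL0.le hLe 519
              _ = Real.exp (519 * (ell D - 1)) := by rw [← Real.exp_nat_mul]; norm_num
          have h9 : (9 : ℝ) ≤ Real.exp 3 := by
            have he := Real.exp_one_gt_d9
            have h3 : Real.exp 3 = Real.exp 1 * Real.exp 1 * Real.exp 1 := by
              rw [← Real.exp_add, ← Real.exp_add]; norm_num
            rw [h3]; nlinarith [Real.exp_pos (1 : ℝ)]
          have hexp : 4 * (3 + 519 * (ell D - 1)) ≤ ell D ^ 9 := by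
            have h8 : (80 : ℝ) ^ 8 ≤ ell D ^ 8 := pow_le_pow_left₀ (by norm_num) h80 8
            have : ell D ^ 9 = ell D ^ 8 * ell D := by ring
            nlinarith
          calc (9 * ell D ^ 519) ^ 4 ≤ (Real.exp 3 * Real.exp (519 * (ell D - 1))) ^ 4 :=
                pow_le_pow_left₀ (by positivity) (mul_le_mul h9 h1 (by positivity) (Real.exp_pos _).le) 4
            _ = Real.exp (4 * (3 + 519 * (ell D - 1))) := by
                rw [← Real.exp_add, ← Real.exp_nat_mul]; norm_num
            _ ≤ Real.exp (ell D ^ 9) := Real.exp_le_exp.mpr hexp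
        have ht9 : 0 ≤ 9 * t0 D := by rw [t0]; positivity
        have hbigP0 : 0 ≤ bigP D := (Real.exp_pos _).le
        calc 32 * (9 * t0 D) ^ 3 * bigP D ^ 3 ≤ (9 * t0 D) * (9 * t0 D) ^ 3 * bigP D ^ 3 :=
              mul_le_mul_of_nonneg_right (mul_le_mul_of_nonneg_right (by linarith) (pow_nonneg ht9 3))
                (pow_nonneg hbigP0 3)
          _ = (9 * t0 D) ^ 4 * bigP D ^ 3 := by ring
          _ ≤ bigP D * bigP D ^ 3 := by gcongr
    _ = Zc * bigP D ^ 4 := by ring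

end Literature.NumberTheory.LFunctions.Zhang2022.Typed.Section13

end
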